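import Summits.BirchSwinnertonDyer.Rank1Residual.GaloisImage.PropagatedStructureCartesian
import Summits.BirchSwinnertonDyer.Rank1Residual.GaloisImage.KolyvaginScalarTransportLocal
import HarnessLib

/-!
# Route `KimAtThreeKolyvagin` (rung W2), crux `StubAtEmptyLevelThree` (item 19561): the propagated structure
# is CARTESIAN at every gap `E[3^{j+1}] ↪ E[3^{k+1}]` (Mazur–Rubin Lemma 4.1.1 (i), local half)

Cell `bsd-addord`, seat `bsd-addord-w2-c2` (gen 3). TOOL FILE: one theorem, no definition, no named fact, no
`sorry`; closes nothing; books nothing. HONEST FRAMING: BSD is not proved by any of this; item 19561 stays OPEN.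

Cell n1011's `isCartesianAt_propagatedSelmerStructure` (seat p13) is the case `j = 0` (`E[p] ↪ E[p^{k+1}]`,
Sakamoto Def. 3.5). The "stub from liftability" road for item 19561 needs the local half of Mazur–Rubin's
Lemma 4.1.1 (i) — `H¹_𝓕(ℚ, T/𝔪^iT) ≅ H¹_𝓕(ℚ, T)[𝔪^i]` — at an arbitrary gap, whose non-formal input is exactly
this: a local class of `E[3^{j+1}]` whose image under `incl_*` satisfies the propagated condition at level `k`
satisfies it at level `j`. Same cocycle proof as p13's, with the shift `η / 3^{k−j}` (`tateDivPow (k − j)`)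
instead of `η / 3^k`.

* `mem_propagatedSelmerStructure_of_localMap_torsionInclusion_mem_of_le` — for `j ≤ k`, every place `v` and
  `x ∈ H¹(ℚ_v, E[3^j·3])`: `incl_* x ∈ 𝓕_can^{(k)}(v) ⟹ x ∈ 𝓕_can^{(j)}(v)`.

References: [MazurRubin2004] Lemma 3.5.4, Lemma 4.1.1 (i) (p. 35), Lemma 3.7.1 (`𝓕_can` cartesian);
[Sakamoto2024] Def. 3.5 (p. 923); [SilvermanAEC2009] III.§7.
-/

-- the Theorems namespace of a single-conjunct summit repeats the summit name by design (D-0017)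
set_option linter.dupNamespace false

noncomputable section

open scoped Classical NumberField ContRepresentation
open Field NumberField IsDedekindDomain WeierstrassCurve Literature.NumberTheory.EllipticCurves
  Literature.NumberTheory.GaloisRepresentations Literature.NumberTheory.GaloisRepresentations.DiscreteGaloisModule
  Summit.BirchSwinnertonDyer.Rank1Residual.GaloisImage

namespace Summit.BirchSwinnertonDyer.BirchSwinnertonDyer.Theorems.KimAtThreeStubOfLiftable

/-- **`𝓕_can` is cartesian at the gap `E[3^{j+1}] ↪ E[3^{k+1}]`** (`j ≤ k`, every place): if the image of a
local class `x ∈ H¹(ℚ_v, E[3^j·3])` under `incl_*` lies in `im(H¹(ℚ_v, T₃E) → H¹(ℚ_v, E[3^k·3]))`, then `x`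
lies in `im(H¹(ℚ_v, T₃E) → H¹(ℚ_v, E[3^j·3]))`. Cocycle proof: `incl ∘ ξ = π_{k+1} ∘ η + ∂t`; lift `t` to
`T₃E` and absorb it; then `π_{k−j}(η) = 0`, and `η / 3^{k−j}` is a crossed homomorphism with
`π_{j+1} ∘ (η / 3^{k−j}) = ξ`. [cite: MazurRubin2004, Lemma 4.1.1 (i) (p. 35) and Lemma 3.7.1]
[cite: Sakamoto2024, Def. 3.5 (p. 923)] -/
theorem mem_propagatedSelmerStructure_of_localMap_torsionInclusion_mem_of_le
    (W : WeierstrassCurve ℚ) [W.IsElliptic] {j k : ℕ} (hjk : j ≤ k) (v : Place ℚ)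
    {x : galoisCohomology ((W.torsionGaloisModule (((3 : ℕ) : ℤ) ^ j * ((3 : ℕ) : ℤ))).toLocal v) 1}
    (hx : DiscreteGaloisModule.localMap (W.torsionInclusion (Transport.pow_mul_dvd_pow_mul hjk)) v x ∈
      propagatedSelmerStructure W 3 k v) :
    x ∈ propagatedSelmerStructure W 3 j v := by
  haveI : Fact (Nat.Prime 3) := ⟨Nat.prime_three⟩
  obtain ⟨ξ, rfl⟩ := oneCocycleClass_surjective
    ((W.torsionGaloisModule (((3 : ℕ) : ℤ) ^ j * ((3 : ℕ) : ℤ))).toLocal v).toTopRep x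
  obtain ⟨y, hy⟩ := (mem_propagatedSelmerStructure_iff W 3 k v _).mp hx
  obtain ⟨η, rfl⟩ := oneCocycleClass_surjective (tateLocalRep W 3 v).toTopRep y
  rw [tateLocalMap_oneCocycleClass] at hy
  erw [galoisCohomology.map_one_oneCocycleClass] at hy
  obtain ⟨t, ht⟩ := exists_sub_eq_of_oneCocycleClass_eq _ _ _ hy
  -- `ht g`, on underlying points: `(η g)_{k+1} - ξ g = g t - t`
  have ht' : ∀ g : absoluteGaloisGroup (Place.Completion v),
      TateModule.proj 3 (k + 1) (η.1 g) -
          ((ξ.1 g : geomTorsion W (((3 : ℕ) : ℤ) ^ j * ((3 : ℕ) : ℤ))) : geomPoints W) =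
        absGaloisRestrict ℚ (Place.Completion v) g • (t : geomPoints W) - (t : geomPoints W) := by
    intro g
    exact congrArg (fun P : geomTorsion W (((3 : ℕ) : ℤ) ^ k * ((3 : ℕ) : ℤ)) => (P : geomPoints W)) (ht g)
  -- lift `t` to `T₃E` and absorb its coboundary into `η`
  obtain ⟨tT, htT⟩ := proj_surjective_of_isAlgClosed_holds W 3 (k + 1)
    ((mem_geomTorsion_pow_mul_iff W 3 k _).mp t.2)
  set η' : contOneCocycles (tateLocalRep W 3 v).toTopRep :=
    η - principalCocycle _ tT (continuous_tateLocalRep_apply W 3 v tT) with hη'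
  have hη'apply : ∀ g : absoluteGaloisGroup (Place.Completion v),
      η'.1 g = η.1 g - ((tateLocalRep W 3 v).toTopRep.ρ g tT - tT) := fun g => rfl
  -- `(η' g)_{k+1} = ξ g`
  have hkey : ∀ g : absoluteGaloisGroup (Place.Completion v),
      TateModule.proj 3 (k + 1) (η'.1 g) =
        ((ξ.1 g : geomTorsion W (((3 : ℕ) : ℤ) ^ j * ((3 : ℕ) : ℤ))) : geomPoints W) := by
    intro g
    rw [hη'apply, map_sub, map_sub, ContinuousRep.toTopRep_ρ_apply, tateLocalRep_apply_apply,
      TateModule.proj_smul_of_distribMulAction, htT, ← ht' g]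
    abel
  -- hence `(η' g)_{k-j} = 0` (`ξ g ∈ E[3^{j+1}]`, and `3^{j+1} • a_{k+1} = a_{k-j}`)
  have hk0 : ∀ g : absoluteGaloisGroup (Place.Completion v), TateModule.proj 3 (k - j) (η'.1 g) = 0 := by
    intro g
    have e : k + 1 = (j + 1) + (k - j) := by omega
    rw [← TateModule.pow_smul_proj_self_add (j + 1) (k - j) (η'.1 g), ← e, hkey]
    have hmem := Transport.pow_succ_nsmul_geomTorsion W j (ξ.1 g)
    exact congrArg Subtype.val hmem
  -- the divided crossed homomorphism `η'' = η' / 3^{k-j}`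
  let f'' : absoluteGaloisGroup (Place.Completion v) → W.tateModule 3 :=
    fun g => tateDivPow (k - j) (η'.1 g) (hk0 g)
  have hf''val : ∀ (g : absoluteGaloisGroup (Place.Completion v)) (n : ℕ),
      TateModule.proj 3 n (f'' g) = TateModule.proj 3 (n + (k - j)) (η'.1 g) := fun g n => rfl
  have hcont'' : Continuous f'' :=
    continuous_induced_rng.2
      (continuous_pi fun n => (TateModule.continuous_proj (n + (k - j))).comp η'.1.continuous)
  have hcoc'' : ∀ g h : absoluteGaloisGroup (Place.Completion v),
      f'' (g * h) = f'' g + (tateLocalRep W 3 v).toTopRep.ρ g (f'' h) := by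
    intro g h
    apply TateModule.ext
    intro n
    rw [hf''val, map_add, hf''val, ContinuousRep.toTopRep_ρ_apply, tateLocalRep_apply_apply,
      TateModule.proj_smul_of_distribMulAction, hf''val, η'.2 g h, map_add,
      ContinuousRep.toTopRep_ρ_apply, tateLocalRep_apply_apply,
      TateModule.proj_smul_of_distribMulAction]
  let η'' : contOneCocycles (tateLocalRep W 3 v).toTopRep := ⟨⟨f'', hcont''⟩, hcoc''⟩
  have hη''apply : ∀ g : absoluteGaloisGroup (Place.Completion v), η''.1 g = f'' g := fun g => rfl
  -- conclude: `x = [ξ] = π_{j+1,*} [η'']`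
  refine (mem_propagatedSelmerStructure_iff W 3 j v _).mpr
    ⟨oneCocycleClass (tateLocalRep W 3 v).toTopRep η'', ?_⟩
  rw [tateLocalMap_oneCocycleClass]
  congr 1
  apply Subtype.ext
  apply ContinuousMap.ext
  intro g
  apply Subtype.ext
  rw [pushCocycle_apply, coe_tateToTorsion_apply, hη''apply, hf''val,
    show j + 1 + (k - j) = k + 1 by omega, hkey g]

end Summit.BirchSwinnertonDyer.BirchSwinnertonDyer.Theorems.KimAtThreeStubOfLiftable

end
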